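import Mathlib.RingTheory.Polynomial.Cyclotomic.Basic
import Mathlib.Data.Nat.Choose.Factorization
import Literature.NumberTheory.EllipticCurves.Sprung2017.SharpFlatPAdicLFunction
import HarnessLib

/-!
# Sprung 2017, §3.1 / Thm. 1.1: the (α-free) half-logarithm matrix `ℒ = lim 𝒞_1⋯𝒞_n C^{−(n+2)}` —
# finite approximants, the increment identity and the `3`-adic estimates at `(p, a_p) = (3, ±3)`

Topic `NumberTheory/EllipticCurves`, cluster `Sprung2017` (namespace = path). Definitions WITH bodies +
proved identities; no named fact, no instance, no notation. Companion of `SharpFlatPAdicLFunction.lean`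
(`sprungSeq`, `sharpPoly = u_n`, `flatPoly = v_n`, `IsSprungPair`), whose module docstring lists the matrix
`𝓛og_{α,β}` under "NOT vendored" — this file and its sequel `HalfLogarithmMatrixLimitProofs.lean` vendor its
α-free part at the one supersingular pair with `a_p ≠ 0` that an elliptic curve over `ℚ` can have at an odd
prime, `(p, a_p) = (3, ±3)` (class X8 of the BSD programme).

Source: F. Sprung, *On pairs of `p`-adic `L`-functions for weight-two modular forms*, Algebra & Number
Theory 11 (2017) [Sprung2017], §1 (p. 4 of arXiv:1601.00010): "`Log_{α,β} := lim_{n→∞} 𝒞_1⋯𝒞_n C^{−(n+2)}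
(−1 −1; β α)`, where `𝒞_i := (a_p 1; −ε(p)Φ_{p^i}(1+T) 0)`, `C := (a_p 1; −ε(p)p 0)`" (trivial
nebentypus: `ε(p) = 1`); §3.1 Def. 3.1 / Lemma 3.3 (convergence); Thm. 1.1:
`(L_p(f,α,T), L_p(f,β,T)) = (L♯_p(f,T), L♭_p(f,T))·Log_{α,β}(1+T)`. The first columns of the partial
products are the tree's recursion polynomials: `𝒞_1⋯𝒞_n = (u_{n+1} u_n; v_{n+1} v_n)` (Cor. 4.4; here
`coeff_zero_rowSeq` / the recursion `sprungSeq_add_two`).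

## Contents (everything over `ℚ`, exact; the `3`-adic limit is taken in the sequel)
* `sprungC p a = C`, `sprungCinv p a = C⁻¹ = (0 −1/p; 1 a/p)` (`det C = p`), `sprungC_mul_sprungCinv`;
* `rowSeq a p i n` — row `i` of `𝒞_1⋯𝒞_n`: `u_n` (`i = 0`), `v_n` (`i = 1`);
* `cycloDelta p m = Φ_{p^m}(1+T) − p ∈ ℤ[T]` (`𝒞_m − C = −cycloDelta·E₂₁`), `coeff_zero_cycloDelta`;
* `halfLogApprox p a n : Matrix (Fin 2) (Fin 2) ℚ[T]` — the approximant
  `A_n := (u_{n+1} u_n; v_{n+1} v_n)·C^{−(n+2)}` written entrywise; **`halfLogApprox_succ_sub`** — the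
  INCREMENT IDENTITY `A_{n+1} − A_n = −(Φ_{p^{n+1}}(1+T) − p)·(x_n)·(C^{−(n+3)})_{0k}` (from
  `x_{n+2} = a x_{n+1} − Φ_{p^{n+1}}(1+T) x_n` and `C·C^{−(n+3)} = C^{−(n+2)}`); `coeff_zero_halfLogApprox`
  (`A_n(0) = C^{−2}` for every `n`);
* at `p = 3`, `a = 3b`: `cinvNum b m ∈ M₂(ℤ)` with **`three_pow_smul_sprungCinv_pow`**
  (`3^{⌈m/2⌉}·C^{−m} ∈ M₂(ℤ)`), and Kummer's `3^{n − ⌊log₃ j⌋} ∣ coeff_s(Φ_{3^{n+1}}(1+T) − 3)` for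
  `1 ≤ s ≤ j` (`pow_dvd_coeff_cycloDelta`), hence **`pow_dvd_coeff_cycloDelta_mul`** — the numerator of
  the `j`-th coefficient of the increment is divisible by `3^{n − ⌊log₃ j⌋}` while its denominator is
  `3^{⌈(n+3)/2⌉}`: the coefficientwise `3`-adic Cauchy estimate used by the sequel.
HONEST FRAMING: transcription of printed definitions + elementary algebra; nothing about any curve;
BSD is not proved by any of this. Consumer: the crux line `chromatic-common-zeros` of
stmt-BirchSwinnertonDyer-19875, stub S0 (both colours `L♯, L♭ ≠ 0` on class X8), via the functional
equation of the completed pair (Sprung 2017 Cor. 4.6 / Cor. 4.14).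
-/

noncomputable section

open Polynomial

namespace Literature.NumberTheory.EllipticCurves.Sprung2017

/-! ## §1 The constant matrices `C = (a 1; −p 0)` and `C⁻¹` -/

/-- Sprung's `C := (a_p 1; −ε(p)p 0)` with trivial nebentypus, over `ℚ`.
[cite: Sprung2017, §1 (definition of Log_{α,β}) and §3.1] -/
def sprungC (p : ℕ) (a : ℤ) : Matrix (Fin 2) (Fin 2) ℚ := !![(a : ℚ), 1; -(p : ℚ), 0]

/-- `C⁻¹ = (0 −1/p; 1 a/p)` (`det C = p`). [cite: Sprung2017, §1 (definition of Log_{α,β})] -/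
def sprungCinv (p : ℕ) (a : ℤ) : Matrix (Fin 2) (Fin 2) ℚ := !![0, -1 / (p : ℚ); 1, (a : ℚ) / p]

section Constants

variable (p : ℕ) [Fact p.Prime] (a : ℤ)

/-- `(p : ℚ) ≠ 0` (private plumbing). [folklore] -/
private theorem p_ne_zero_rat : (p : ℚ) ≠ 0 := by
  exact_mod_cast (Fact.out : p.Prime).ne_zero

/-- `C · C⁻¹ = 1`. [cite: Sprung2017, §1 (definition of Log_{α,β})] -/
theorem sprungC_mul_sprungCinv : sprungC p a * sprungCinv p a = 1 := by
  have hp := p_ne_zero_rat p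
  ext i j
  fin_cases i <;> fin_cases j
  · simp [sprungC, sprungCinv, Matrix.mul_apply, Fin.sum_univ_two]
  · simp [sprungC, sprungCinv, Matrix.mul_apply, Fin.sum_univ_two]
    ring
  · simp [sprungC, sprungCinv, Matrix.mul_apply, Fin.sum_univ_two]
  · simp [sprungC, sprungCinv, Matrix.mul_apply, Fin.sum_univ_two]
    field_simp

/-- `C⁻¹ · C = 1`. [cite: Sprung2017, §1 (definition of Log_{α,β})] -/
theorem sprungCinv_mul_sprungC : sprungCinv p a * sprungC p a = 1 := by
  have hp := p_ne_zero_rat p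
  ext i j
  fin_cases i <;> fin_cases j <;> simp [sprungC, sprungCinv, Matrix.mul_apply, Fin.sum_univ_two, hp]

/-- `C · C^{−(m+1)} = C^{−m}`. [cite: Sprung2017, §1 (definition of Log_{α,β})] -/
theorem sprungC_mul_sprungCinv_pow_succ (m : ℕ) :
    sprungC p a * sprungCinv p a ^ (m + 1) = sprungCinv p a ^ m := by
  rw [pow_succ', ← mul_assoc, sprungC_mul_sprungCinv, one_mul]

omit [Fact p.Prime] in
/-- Row `0` of `C·M`: `(C M)_{0k} = a·M_{0k} + M_{1k}`. [cite: Sprung2017, §1 (definition of Log_{α,β})] -/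
theorem sprungC_mul_apply_zero (M : Matrix (Fin 2) (Fin 2) ℚ) (k : Fin 2) :
    (sprungC p a * M) 0 k = (a : ℚ) * M 0 k + M 1 k := by
  simp [sprungC, Matrix.mul_apply, Fin.sum_univ_two]

omit [Fact p.Prime] in
/-- Row `1` of `C·M`: `(C M)_{1k} = −p·M_{0k}`. [cite: Sprung2017, §1 (definition of Log_{α,β})] -/
theorem sprungC_mul_apply_one (M : Matrix (Fin 2) (Fin 2) ℚ) (k : Fin 2) :
    (sprungC p a * M) 1 k = -(p : ℚ) * M 0 k := by
  simp [sprungC, Matrix.mul_apply, Fin.sum_univ_two]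

end Constants

/-! ## §2 The rows of `𝒞_1⋯𝒞_n`: `u_n` and `v_n` -/

/-- Row `i` of the partial product `𝒞_1⋯𝒞_n = (u_{n+1} u_n; v_{n+1} v_n)`: `rowSeq a p 0 n = u_n`
(`sharpPoly`), `rowSeq a p 1 n = v_n` (`flatPoly`). [cite: Sprung2017, Cor. 4.4 (first column of 𝒞_1⋯𝒞_n Ã⁻¹)] -/
def rowSeq (a : ℤ) (p : ℕ) (i : Fin 2) (n : ℕ) : ℤ[X] :=
  if i = 0 then sharpPoly a p n else flatPoly a p n

/-- `rowSeq a p 0 = sharpPoly`. [cite: Sprung2017, Cor. 4.4] -/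
@[simp] theorem rowSeq_zero (a : ℤ) (p : ℕ) (n : ℕ) : rowSeq a p 0 n = sharpPoly a p n := rfl

/-- `rowSeq a p 1 = flatPoly`. [cite: Sprung2017, Cor. 4.4] -/
@[simp] theorem rowSeq_one (a : ℤ) (p : ℕ) (n : ℕ) : rowSeq a p 1 n = flatPoly a p n := rfl

/-- The recursion `x_{n+2} = a x_{n+1} − Φ_{p^{n+1}}(1+T) x_n` for either row.
[cite: Sprung2017, §4 Cor. 4.4] -/
theorem rowSeq_add_two (a : ℤ) (p : ℕ) (i : Fin 2) (n : ℕ) :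
    rowSeq a p i (n + 2) = C a * rowSeq a p i (n + 1) -
      (cyclotomic (p ^ (n + 1)) ℤ).comp (X + 1) * rowSeq a p i n := by
  fin_cases i
  · exact sharpPoly_add_two a p n
  · exact flatPoly_add_two a p n

/-! ## §3 `𝒞_m − C`: the polynomial `Φ_{p^m}(1+T) − p` -/

/-- `cycloDelta p m = Φ_{p^m}(1+T) − p ∈ ℤ[T]`, the one non-zero entry of `C − 𝒞_m` (up to sign).
[cite: Sprung2017, §3.1 (𝒞_i − C)] -/
def cycloDelta (p : ℕ) (m : ℕ) : ℤ[X] := (cyclotomic (p ^ m) ℤ).comp (X + 1) - (p : ℤ[X])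

/-- `Φ_{p^{m+1}}(1) = p`, so `cycloDelta p (m+1)` has no constant term. [cite: Sprung2017, §3.1 (𝒞_i(ζ) = C at ζ = 1)] -/
theorem coeff_zero_cycloDelta (p : ℕ) [hp : Fact p.Prime] (m : ℕ) : (cycloDelta p (m + 1)).coeff 0 = 0 := by
  rw [cycloDelta, coeff_sub, coeff_zero_eq_eval_zero, eval_comp, eval_add, eval_X, eval_one, zero_add,
    eval_one_cyclotomic_prime_pow, coeff_natCast_ite, if_pos rfl, sub_self]

/-! ## §4 The approximants `A_n = (u_{n+1} u_n; v_{n+1} v_n)·C^{−(n+2)}` and the increment identity -/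

/-- **The `n`-th approximant of the α-free half-logarithm matrix**, `A_n := 𝒞_1⋯𝒞_n·C^{−(n+2)} =
(u_{n+1} u_n; v_{n+1} v_n)·C^{−(n+2)}`, written entrywise over `ℚ[T]`:
`(A_n)_{ik} = x^{(i)}_{n+1}·(C^{−(n+2)})_{0k} + x^{(i)}_n·(C^{−(n+2)})_{1k}`. Sprung's `Log_{α,β}` is
`(lim_n A_n)·(−1 −1; β α)`. [cite: Sprung2017, §1 and §3.1 (Log_{α,β} = lim 𝒞_1⋯𝒞_n C^{−(n+2)} (−1 −1; β α))] -/
def halfLogApprox (p : ℕ) (a : ℤ) (n : ℕ) : Matrix (Fin 2) (Fin 2) ℚ[X] := fun i k =>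
  (rowSeq a p i (n + 1)).map (Int.castRingHom ℚ) * C ((sprungCinv p a ^ (n + 2)) 0 k) +
    (rowSeq a p i n).map (Int.castRingHom ℚ) * C ((sprungCinv p a ^ (n + 2)) 1 k)

/-- **Increment identity**: `A_{n+1} − A_n = −(Φ_{p^{n+1}}(1+T) − p)·x^{(i)}_n·(C^{−(n+3)})_{0k}`
entrywise (`𝒞_1⋯𝒞_n(𝒞_{n+1} − C)C^{−(n+3)}` with `𝒞_{n+1} − C = −(Φ_{p^{n+1}}(1+T) − p)E₂₁`).
[cite: Sprung2017, §3.1 Lemma 3.3 (the increments of the partial products)] -/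
theorem halfLogApprox_succ_sub (p : ℕ) [Fact p.Prime] (a : ℤ) (n : ℕ) (i k : Fin 2) :
    halfLogApprox p a (n + 1) i k - halfLogApprox p a n i k =
      -((cycloDelta p (n + 1)).map (Int.castRingHom ℚ) * (rowSeq a p i n).map (Int.castRingHom ℚ)) *
        C ((sprungCinv p a ^ (n + 3)) 0 k) := by
  -- `C^{−(n+2)} = C · C^{−(n+3)}` read on rows
  have h0 : (sprungCinv p a ^ (n + 2)) 0 k =
      (a : ℚ) * (sprungCinv p a ^ (n + 3)) 0 k + (sprungCinv p a ^ (n + 3)) 1 k := by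
    rw [← sprungC_mul_sprungCinv_pow_succ p a (n + 2), sprungC_mul_apply_zero]
  have h1 : (sprungCinv p a ^ (n + 2)) 1 k = -(p : ℚ) * (sprungCinv p a ^ (n + 3)) 0 k := by
    rw [← sprungC_mul_sprungCinv_pow_succ p a (n + 2), sprungC_mul_apply_one]
  -- the recursion `x_{n+2} = a x_{n+1} − Φ x_n`, mapped to `ℚ[T]`
  have hrec := congrArg (Polynomial.map (Int.castRingHom ℚ)) (rowSeq_add_two a p i n)
  rw [Polynomial.map_sub, Polynomial.map_mul, Polynomial.map_mul, Polynomial.map_C, eq_intCast] at hrec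
  simp only [halfLogApprox, cycloDelta, Polynomial.map_sub, Polynomial.map_natCast,
    show n + 1 + 1 = n + 2 from rfl, show n + 1 + 2 = n + 3 from rfl, h0, h1, hrec, map_add, map_mul,
    map_neg, map_natCast]
  ring

/-- `x^{(i)}_0`, `x^{(i)}_1` are the constants `(u_0, u_1) = (0, 1)`, `(v_0, v_1) = (1, 0)`:
`𝒞_1⋯𝒞_0 = 1`. [cite: Sprung2017, Cor. 4.4] -/
theorem rowSeq_zero_one (a : ℤ) (p : ℕ) (i : Fin 2) :
    rowSeq a p i 1 = C (if i = 0 then 1 else 0) ∧ rowSeq a p i 0 = C (if i = 0 then 0 else 1) := by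
  fin_cases i <;> simp [rowSeq]

/-- `A_0 = C^{−2}` entrywise (constant polynomials). [cite: Sprung2017, §3.1] -/
theorem halfLogApprox_zero (p : ℕ) (a : ℤ) (i k : Fin 2) :
    halfLogApprox p a 0 i k = C ((sprungCinv p a ^ 2) i k) := by
  fin_cases i <;> simp [halfLogApprox]

/-- **`A_n(0) = C^{−2}` for every `n`** (`𝒞_m(0) = C` since `Φ_{p^m}(1) = p`, so
`A_n(0) = C^n C^{−(n+2)}`): by the increment identity, whose right-hand side has no constant term.
[cite: Sprung2017, §3.1 (𝒞_i(ζ_{p^0}) = C)] -/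
theorem coeff_zero_halfLogApprox (p : ℕ) [Fact p.Prime] (a : ℤ) (n : ℕ) (i k : Fin 2) :
    (halfLogApprox p a n i k).coeff 0 = (sprungCinv p a ^ 2) i k := by
  induction n with
  | zero => rw [halfLogApprox_zero, coeff_C_zero]
  | succ n ih =>
    have h := congrArg (fun q : ℚ[X] => q.coeff 0) (halfLogApprox_succ_sub p a n i k)
    rw [coeff_sub, coeff_mul_C, coeff_neg, mul_coeff_zero, Polynomial.coeff_map, coeff_zero_cycloDelta,
      map_zero, zero_mul, neg_zero, zero_mul, sub_eq_zero] at h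
    rw [h, ih]

/-! ## §5 `p = 3`, `a = 3b`: integrality of `3^{⌈m/2⌉}·C^{−m}` -/

/-- The integer matrices `J_m` with `3^{⌈m/2⌉}·C^{−m} = J_m` (`C = (3b 1; −3 0)`): `J_0 = 1`,
`J_1 = 3C⁻¹ = (0 −1; 3 3b)`, `J_{m+2} = J_m·(3C^{−2})`, `3C^{−2} = (−1 −b; 3b 3b²−1)`.
[cite: Sprung2017, §3.1 (valuation of C^{−n}: the eigenvalues of C have valuation 1/2)] -/
def cinvNum (b : ℤ) : ℕ → Matrix (Fin 2) (Fin 2) ℤ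
  | 0 => 1
  | 1 => !![0, -1; 3, 3 * b]
  | m + 2 => cinvNum b m * !![-1, -b; 3 * b, 3 * b ^ 2 - 1]

/-- `3·C⁻¹ = (0 −1; 3 3b)` at `(p, a) = (3, 3b)`. [cite: Sprung2017, §3.1] -/
theorem three_smul_sprungCinv (b : ℤ) :
    (3 : ℚ) • sprungCinv 3 (3 * b) =
      (Int.castRingHom ℚ).mapMatrix (!![0, -1; 3, 3 * b] : Matrix (Fin 2) (Fin 2) ℤ) := by
  ext i j
  fin_cases i <;> fin_cases j <;> norm_num [sprungCinv]

/-- `3·C^{−2} = (−1 −b; 3b 3b²−1)` at `(p, a) = (3, 3b)`. [cite: Sprung2017, §3.1] -/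
theorem three_smul_sprungCinv_sq (b : ℤ) :
    (3 : ℚ) • sprungCinv 3 (3 * b) ^ 2 =
      (Int.castRingHom ℚ).mapMatrix (!![-1, -b; 3 * b, 3 * b ^ 2 - 1] : Matrix (Fin 2) (Fin 2) ℤ) := by
  ext i j
  fin_cases i <;> fin_cases j <;> simp [sprungCinv, pow_two] <;> ring

/-- **`3^{⌈m/2⌉}·C^{−m} = J_m ∈ M₂(ℤ)`** at `(p, a) = (3, 3b)` (`⌈m/2⌉ = (m+1)/2`).
[cite: Sprung2017, §3.1 (valuation of C^{−n})] -/
theorem three_pow_smul_sprungCinv_pow (b : ℤ) (m : ℕ) :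
    (3 : ℚ) ^ ((m + 1) / 2) • sprungCinv 3 (3 * b) ^ m = (Int.castRingHom ℚ).mapMatrix (cinvNum b m) := by
  induction m using Nat.twoStepInduction with
  | zero => simp [cinvNum]
  | one => simpa [cinvNum] using three_smul_sprungCinv b
  | more m ih _ =>
    have e1 : ((3 : ℚ) ^ ((m + 1) / 2) • sprungCinv 3 (3 * b) ^ m) * ((3 : ℚ) • sprungCinv 3 (3 * b) ^ 2) =
        (3 : ℚ) ^ ((m + 2 + 1) / 2) • sprungCinv 3 (3 * b) ^ (m + 2) := by
      rw [Matrix.smul_mul, Matrix.mul_smul, smul_smul, ← pow_add, ← pow_succ,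
        show m + 2 + 1 = (m + 1) + 2 from rfl, Nat.add_div_right _ two_pos]
    rw [← e1, ih, three_smul_sprungCinv_sq, ← map_mul]
    rfl

/-! ## §6 `p = 3`: Kummer's congruences for the coefficients of `Φ_{3^{n+1}}(1+T) − 3` -/

/-- `Φ_{3^{n+1}}(1+T) − 3 = (U − 1)(U + 2)` with `U = (1+T)^{3ⁿ}` (`Φ_{p^{n+1}}(X) = 1 + X^{pⁿ} + X^{2pⁿ}`
at `p = 3`). [cite: Sprung2017, §3.1] -/
theorem cycloDelta_three_eq (n : ℕ) :
    cycloDelta 3 (n + 1) = ((X + 1) ^ 3 ^ n - 1) * ((X + 1) ^ 3 ^ n + 2) := by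
  rw [cycloDelta, cyclotomic_prime_pow_eq_geom_sum Nat.prime_three]
  simp only [Finset.sum_range_succ, Finset.sum_range_zero, pow_zero, pow_one, zero_add, add_comp,
    one_comp, pow_comp, X_comp]
  push_cast
  ring

/-- Kummer at a prime power: `3^{n − ⌊log₃ s⌋} ∣ C(3ⁿ, s)` for `1 ≤ s` (`v₃ C(3ⁿ, s) = n − v₃(s)` for
`s ≤ 3ⁿ`, Mathlib `Nat.factorization_choose_prime_pow`; `C(3ⁿ, s) = 0` beyond); private plumbing. [folklore] -/
private theorem pow_dvd_choose_three_pow (n s : ℕ) (hs : 1 ≤ s) :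
    3 ^ (n - Nat.log 3 s) ∣ Nat.choose (3 ^ n) s := by
  rcases le_or_gt s (3 ^ n) with hle | hlt
  · have hfac := Nat.factorization_choose_prime_pow Nat.prime_three hle (by omega)
    have hv : s.factorization 3 ≤ Nat.log 3 s := by
      apply Nat.le_log_of_pow_le (by norm_num)
      exact Nat.ordProj_le 3 (by omega)
    calc 3 ^ (n - Nat.log 3 s) ∣ 3 ^ (n - s.factorization 3) := pow_dvd_pow 3 (by omega)
      _ = 3 ^ ((Nat.choose (3 ^ n) s).factorization 3) := by rw [hfac]
      _ ∣ Nat.choose (3 ^ n) s := Nat.ordProj_dvd _ _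
  · rw [Nat.choose_eq_zero_of_lt hlt]
    exact dvd_zero _

/-- The coefficients of `(1+T)^{3ⁿ} − 1` in degrees `1 ≤ s ≤ j` are divisible by `3^{n − ⌊log₃ j⌋}`
(and the constant coefficient vanishes); private plumbing. [folklore] -/
private theorem pow_dvd_coeff_X_add_one_pow_sub_one (n j s : ℕ) (hsj : s ≤ j) :
    (3 : ℤ) ^ (n - Nat.log 3 j) ∣ (((X + 1 : ℤ[X]) ^ 3 ^ n - 1).coeff s) := by
  rcases Nat.eq_zero_or_pos s with rfl | hs
  · rw [coeff_sub, coeff_X_add_one_pow, Nat.choose_zero_right, Nat.cast_one, coeff_one_zero, sub_self]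
    exact dvd_zero _
  · rw [coeff_sub, coeff_X_add_one_pow, coeff_one, if_neg (by omega), sub_zero]
    have h := pow_dvd_choose_three_pow n s hs
    have hlog : Nat.log 3 s ≤ Nat.log 3 j := Nat.log_mono_right hsj
    calc (3 : ℤ) ^ (n - Nat.log 3 j) ∣ (3 : ℤ) ^ (n - Nat.log 3 s) := pow_dvd_pow 3 (by omega)
      _ ∣ ((Nat.choose (3 ^ n) s : ℕ) : ℤ) := by exact_mod_cast h

/-- **Kummer for `Φ_{3^{n+1}}(1+T) − 3`**: its coefficients in degrees `s ≤ j` are divisible by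
`3^{n − ⌊log₃ j⌋}` (write it as `(U−1)(U+2)`, `U = (1+T)^{3ⁿ}`, and use the divisibility of the
coefficients of `U − 1`); private plumbing. [folklore] -/
private theorem pow_dvd_coeff_cycloDelta (n j s : ℕ) (hsj : s ≤ j) :
    (3 : ℤ) ^ (n - Nat.log 3 j) ∣ (cycloDelta 3 (n + 1)).coeff s := by
  rw [cycloDelta_three_eq, coeff_mul]
  refine Finset.dvd_sum fun x hx => ?_
  have hx1 : x.1 ≤ j := by
    have := Finset.HasAntidiagonal.mem_antidiagonal.mp hx
    omega
  exact (pow_dvd_coeff_X_add_one_pow_sub_one n j x.1 hx1).mul_right _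

/-- **The numerator estimate of the increment** (the valuation estimate behind the convergence of the
partial products, Sprung 2017 §3.1 Lemma 3.3, at `p = 3`): for any `g ∈ ℤ[T]` (here `g = x^{(i)}_n`), the
coefficients of `(Φ_{3^{n+1}}(1+T) − 3)·g` in degrees `≤ j` are divisible by `3^{n − ⌊log₃ j⌋}` (Kummer's
congruence `v₃ C(3ⁿ, s) = n − v₃(s)`). [cite: Sprung2017, §3.1 Lemma 3.3 (convergence of 𝒞_1⋯𝒞_n C^{−(n+2)})] -/
theorem pow_dvd_coeff_cycloDelta_mul (n j : ℕ) (g : ℤ[X]) (s : ℕ) (hs : s ≤ j) :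
    (3 : ℤ) ^ (n - Nat.log 3 j) ∣ (cycloDelta 3 (n + 1) * g).coeff s := by
  rw [coeff_mul]
  refine Finset.dvd_sum fun x hx => ?_
  have hx1 : x.1 ≤ j := by
    have := Finset.HasAntidiagonal.mem_antidiagonal.mp hx
    omega
  exact (pow_dvd_coeff_cycloDelta n j x.1 hx1).mul_right _

end Literature.NumberTheory.EllipticCurves.Sprung2017

end
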